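import Summits.BirchSwinnertonDyer.BirchSwinnertonDyer.Theorems.CyclotomicUntwistF1OfStabilisedTwist
import Summits.BirchSwinnertonDyer.BirchSwinnertonDyer.Theorems.CyclotomicUntwistPSUntwistedTraceRootField
import Mathlib.NumberTheory.Cyclotomic.Basic
import Mathlib.FieldTheory.IsAlgClosed.Basic
import Mathlib.Analysis.Complex.Polynomial.Basic
import HarnessLib

/-!
# C1 `PSUntwistedLFunctionAtThree` from PRINT + the STABILISED UNTWIST + the ROOT LAW: the `ℚ(ζ₆)`-bookkeeping
# and the final assembly (route `CyclotomicUntwist`, crux K1 `PSRankOneLowerHalfAtThree`, child C1 = stmt-27548)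

Cell `pub/bsd-wall` (D-0145 line `route-BirchSwinnertonDyer-CyclotomicUntwist`), width seat `bsd-line-cycu-p5`
(gen 13). THEOREMS ONLY (no definition, no named fact, no `sorry`); helper `--supports stmt-BirchSwinnertonDyer-21580`.
BSD is not proved by this file; C1 is NOT closed by it (two hypotheses below are research/print); K1/K2 stay OPEN.

WHAT. `PSF1OfStabilisedTwist.psUntwistedLFunctionAtThree_of_print_of_stabilisedTwist` (cycu-p3 g9, p645878) proves the
crux child C1 VERBATIM from PRINT (modularity, Carayol's level, GZ86 I.(7.3), GZK) plus ONE modular hypothesis (★):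
on every PS row, for a coefficient field `K ↪ ℂ₃, ℂ`, a primitive `η_K` mod `9`, a root `α_K ∈ K` of
`X² − a_w(W)X + 3` and a weight-`2` cusp form `G` on some `Γ₁(L)`, `G − ι(α_K)·G(3·) = κ·∑_u ι(η_K u) f_W(· + u/9)`.
This file SPLITS (★) into its two printed/research sources and does the `ℚ(ζ₆)`-bookkeeping between them:

* (E) the STABILISED UNTWIST in eigenform currency — hypothesis `hE` below, which is LITERALLY the conclusion of
  `PSStabilisedUntwistOfAtkinLi.exists_stabilisedUntwist_of_atkinLi` (cycu-p5, p646568, from the Atkin–Li named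
  fact p646566) at `p = 3`, `c = 2`: for a newform `f` on `Γ₀(N)` and a primitive `η` mod `9` with `η² ≠ 1` there
  is a newform `g₀ ∈ S₂(Γ₁(N₀))`, `3 ∣ N₀`, with `aₙ(g₀) = η⁻¹(n)aₙ(f)` (`3 ∤ n`) and
  `(τ(η)•g₀) − a₃(g₀)·(τ(η)•g₀)(3·) = ∑_u η(u) f(· + u/9)`;
* (N2) the ROOT LAW — hypothesis `hN2` (LAW (T) of `PSUntwistedTraceDefs`; research/print: Deligne + Carayol (A) +
  the inertia analysis on PS rows, lane of the K1 lead cycu-p1 g8): on every PS row there is a primitive `η` mod `9`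
  with `η² ≠ 1` such that every such untwist `g₀` has `a₃(g₀)² − a_w(W)·a₃(g₀) + 3 = 0`;

and proves `psUntwistedLFunctionAtThree_of_print_of_stabilisedUntwist_of_rootLaw : PRINT → hE → hN2 → C1`.
The bookkeeping (§1–§2, kernel): `K = ℚ(ζ₆) = CyclotomicField 6 ℚ` with `ι : K →+* ℂ`, `ι₃ : K →+* ℂ₃`
(`IsAlgClosed.lift`); every primitive `η` mod `9` lifts to `K` along `ι` (`exists_ringHomComp_eq_of_pow_six`: its
values are sixth roots of unity, `#(ℤ/9)ˣ = 6`); a complex root of `X² − a_wX + 3`, `a_w ∈ {0, ±3}`, lifts to a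
root in `K` (`exists_preimage_root_complex`, via `PSUntwistedTrace.exists_preimage_root` and `(2ζ₃+1)² = −3`).

References: [cite: AtkinLi1978, Thm. 3.2] · [cite: MazurTateTeitelbaum1986Invent, §I.14 (case p ∣ N)] ·
[cite: Carayol1986, Thm. (A)] · [cite: GrossZagier1986, Thm. I.(7.3)] · [cite: BCDTJAMS2001, Thm. A].
-/

noncomputable section

open scoped MatrixGroups

open CongruenceSubgroup UpperHalfPlane Complex Function
open Literature.NumberTheory.EllipticCurves Literature.NumberTheory.EllipticCurves.ModularForms
  Literature.NumberTheory.EllipticCurves.Rank1Residual Literature.NumberTheory.IwasawaTheory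
  Summit.BirchSwinnertonDyer.BirchSwinnertonDyer.Theses.CyclotomicUntwist

-- single-conjunct summit: `Summit.BirchSwinnertonDyer.BirchSwinnertonDyer.…` repeats the name by design
set_option linter.dupNamespace false
set_option autoImplicit false

namespace Summit.BirchSwinnertonDyer.BirchSwinnertonDyer.Theorems.PSC1OfStabilisedUntwist

/-! ### §1 Lifting complex Dirichlet characters along an embedding `ι : K →+* ℂ` -/

section Lift

variable {K : Type*} [Field K] (ι : K →+* ℂ) {n : ℕ}

/-- **A complex character whose values lie in `ι(K)` is `χ_K ∘ ι` for a `K`-valued character `χ_K`.** The values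
on units are lifted by choice; multiplicativity of the lift follows from the injectivity of `ι`. [folklore] -/
theorem exists_ringHomComp_eq (χ : DirichletCharacter ℂ n) (h : ∀ u : (ZMod n)ˣ, ∃ z : K, ι z = χ u) :
    ∃ χK : DirichletCharacter K n, χK.ringHomComp ι = χ := by
  choose g hg using h
  have hg0 : ∀ u : (ZMod n)ˣ, g u ≠ 0 := fun u h0 ↦ by
    have h1 := hg u
    rw [h0, map_zero] at h1
    exact (χ.toUnitHom u).ne_zero (by rw [MulChar.coe_toUnitHom]; exact h1.symm)
  let φ : (ZMod n)ˣ →* Kˣ :=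
    { toFun := fun u ↦ Units.mk0 (g u) (hg0 u)
      map_one' := by
        ext
        apply ι.injective
        simp only [Units.val_mk0, hg, Units.val_one, map_one]
      map_mul' := fun u v ↦ by
        ext
        apply ι.injective
        simp only [Units.val_mk0, Units.val_mul, map_mul, hg] }
  refine ⟨MulChar.ofUnitHom φ, MulChar.ext fun u ↦ ?_⟩
  rw [MulChar.ringHomComp_apply, MulChar.ofUnitHom_coe]
  change ι (Units.mk0 (g u) (hg0 u) : K) = χ u
  rw [Units.val_mk0, hg]

/-- Every unit of `ℤ/9ℤ` has order dividing `6` (`#(ℤ/9ℤ)ˣ = φ(9) = 6`). [folklore] -/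
theorem units_zmod_nine_pow_six (u : (ZMod 9)ˣ) : u ^ 6 = 1 := by
  have h : Fintype.card (ZMod 9)ˣ = 6 := by rw [ZMod.card_units_eq_totient]; decide
  rw [← h, pow_card_eq_one]

/-- **A primitive sixth root of unity in `K` lifts every sixth root of unity in `ℂ`** along `ι`. [folklore] -/
theorem exists_map_eq_of_pow_six {μ : K} (hμ : IsPrimitiveRoot μ 6) {w : ℂ} (hw : w ^ 6 = 1) :
    ∃ z : K, ι z = w := by
  obtain ⟨i, -, hi⟩ := (hμ.map_of_injective ι.injective).eq_pow_of_pow_eq_one hw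
  exact ⟨μ ^ i, by rw [map_pow, hi]⟩

/-- **Every Dirichlet character mod `9` with complex values lifts to `K ∋ ζ₆`** along `ι : K →+* ℂ`. [folklore] -/
theorem exists_ringHomComp_eq_of_pow_six {μ : K} (hμ : IsPrimitiveRoot μ 6) (χ : DirichletCharacter ℂ 9) :
    ∃ χK : DirichletCharacter K 9, χK.ringHomComp ι = χ :=
  exists_ringHomComp_eq ι χ fun u ↦ exists_map_eq_of_pow_six ι hμ (by
    rw [← MulChar.coe_toUnitHom, ← Units.val_pow_eq_pow_val, ← map_pow, units_zmod_nine_pow_six, map_one,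
      Units.val_one])

end Lift

/-! ### §2 Roots of `X² − a_w X + 3` in `ℂ` lift to `K ∋ √−3` -/

section Root

variable {K : Type*} [Field K] (ι : K →+* ℂ)

/-- **A complex root of `X² − a_w(W)X + 3` is `ι(α_K)` for a root `α_K ∈ K`**, as soon as `K` contains `δ₀` with
`δ₀² = −3` (`a_w(W) ∈ {0, ±3}`, discriminant `−12` or `−3`; `PSUntwistedTrace.exists_preimage_root`). [folklore] -/
theorem exists_preimage_root_complex {δ₀ : K} (hδ₀ : δ₀ ^ 2 = -3) (W : WeierstrassCurve ℚ) {x : ℂ}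
    (h : x ^ 2 - ((W.psUntwistedTrace : ℤ) : ℂ) * x + 3 = 0) :
    ∃ αK : K, ι αK = x ∧ αK ^ 2 - ((W.psUntwistedTrace : ℤ) : K) * αK + 3 = 0 := by
  have h2 : (2 : ℂ) ≠ 0 := two_ne_zero
  have hι : ι ((W.psUntwistedTrace : ℤ) : K) = ((W.psUntwistedTrace : ℤ) : ℂ) := map_intCast ι _
  rw [← hι] at h
  rcases PSUntwistedTrace.psUntwistedTrace_eq_or W with ha | ha | ha
  · refine PSUntwistedTrace.exists_preimage_root ι h2 (δ := 2 * δ₀) ?_ h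
    rw [ha]; push_cast; linear_combination 4 * hδ₀
  · refine PSUntwistedTrace.exists_preimage_root ι h2 (δ := δ₀) ?_ h
    rw [ha]; push_cast; linear_combination hδ₀
  · refine PSUntwistedTrace.exists_preimage_root ι h2 (δ := δ₀) ?_ h
    rw [ha]; push_cast; linear_combination hδ₀

/-- In `K` with a primitive sixth root of unity `μ`, `δ₀ := 2μ² + 1` satisfies `δ₀² = −3` (`μ²` is a primitive cube
root of unity, `1 + μ² + μ⁴ = 0`). [folklore] -/
theorem exists_sq_eq_neg_three {μ : K} (hμ : IsPrimitiveRoot μ 6) : ∃ δ₀ : K, δ₀ ^ 2 = -3 := by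
  have h3 : IsPrimitiveRoot (μ ^ 2) 3 := hμ.pow (by norm_num) (by norm_num)
  have hsum : 1 + μ ^ 2 + (μ ^ 2) ^ 2 = 0 := by
    have h := h3.geom_sum_eq_zero (by norm_num)
    simpa [Finset.sum_range_succ, pow_succ] using h
  exact ⟨2 * μ ^ 2 + 1, by linear_combination (4 : K) * hsum⟩

end Root

/-! ### §3 C1 from PRINT + the stabilised untwist (E) + the root law (N2) -/

section C1

/-- **C1 `PSUntwistedLFunctionAtThree` ⟸ PRINT + STABILISED UNTWIST + ROOT LAW.** PRINT: modularity
(`nonempty_modularParametrizationData`), Carayol's level (`IsNewformOf.level_eq_conductorNorm`), Gross–Zagier I.(7.3),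
Gross–Zagier–Kolyvagin (`PublishedInputGZK`). `hE` = the stabilised untwist in eigenform currency at `p = 3`, `c = 2`
(= conclusion of `PSStabilisedUntwistOfAtkinLi.exists_stabilisedUntwist_of_atkinLi`, i.e. Atkin–Li 1978 Thm. 3.2 by
name + kernel). `hN2` = the ROOT LAW: on every PS row some primitive `η` mod `9` with `η² ≠ 1` (the untwisting
character) makes `a₃(g₀)` a root of `X² − a_w(W)X + 3` for every newform `g₀` (`3 ∣` level) carrying the packet
`aₙ(g₀) = η⁻¹(n)aₙ(f_W)` off `3` — research/print (Deligne, Carayol (A), Néron–Ogg–Shafarevich over `ℚ₃(ζ₉)`), NOT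
proved here. Assembly: `K = ℚ(ζ₆)`, lift `η` and `a₃(g₀)` to `K` (§1–§2), `G := τ(η)•g₀`, `κ := 1`, and
`PSF1OfStabilisedTwist.psUntwistedLFunctionAtThree_of_print_of_stabilisedTwist`. [cite: AtkinLi1978, Thm. 3.2]
[cite: MazurTateTeitelbaum1986Invent, §I.14 (case p ∣ N)] [cite: Carayol1986, Thm. (A)] [cite: GrossZagier1986, Thm. I.(7.3)] -/
theorem psUntwistedLFunctionAtThree_of_print_of_stabilisedUntwist_of_rootLaw
    (hmod : nonempty_modularParametrizationData)
    (hlev : ∀ (N : ℕ) [NeZero N], IsNewformOf.level_eq_conductorNorm (N := N))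
    (hGZ86 : GrossZagier1986_thm_I_7_3) (hGZK : PublishedInputGZK)
    (hE : ∀ {N : ℕ} [NeZero N] {f : CuspForm (Gamma0 N) 2}, IsNewform0 f →
      ∀ {η : DirichletCharacter ℂ (3 ^ 2)}, η.IsPrimitive → η ^ 2 ≠ 1 →
      ∃ (N₀ : ℕ) (_ : NeZero N₀) (g₀ : CuspForm (Gamma1 N₀) 2), IsNewform1 g₀ ∧ N₀ ∣ Nat.lcm N ((3 ^ 2) ^ 2) ∧
        3 ∣ N₀ ∧ (∀ n : ℕ, ¬ 3 ∣ n → cuspCoeff g₀ n = η⁻¹ (n : ZMod (3 ^ 2)) * cuspCoeff f n) ∧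
        ∀ τ : ℍ, (gaussSum η (ZMod.stdAddChar (N := 3 ^ 2)) • g₀) τ -
            cuspCoeff g₀ 3 * (gaussSum η (ZMod.stdAddChar (N := 3 ^ 2)) • g₀)
              (ofComplex (((3 : ℕ) : ℂ) * (τ : ℂ))) =
          1 * ∑ u : ZMod (3 ^ 2), η u * f ((((u.val : ℚ) / ((3 : ℕ) : ℚ) ^ 2 : ℚ) : ℝ) +ᵥ τ))
    (hN2 : ∀ (W : WeierstrassCurve ℚ) [W.IsElliptic] [W.IsGloballyMinimal], ¬ W.HasCM →
      Summit.BirchSwinnertonDyer.Rank1Residual.Additive.ClassO6 W 3 → Surj W 3 →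
      Even (padicValInt 3 W.minimalDiscriminantInt) →
      W.minimalDiscriminantInt / 3 ^ padicValInt 3 W.minimalDiscriminantInt % 3 = 1 →
      W.analyticRank = 1 →
      ∀ {N : ℕ} [NeZero N] (f : CuspForm (Gamma0 N) 2), IsNewformOf W f →
      ∃ η : DirichletCharacter ℂ (3 ^ 2), η.IsPrimitive ∧ η ^ 2 ≠ 1 ∧
        ∀ {N₀ : ℕ} [NeZero N₀] (g₀ : CuspForm (Gamma1 N₀) 2), IsNewform1 g₀ → 3 ∣ N₀ →
          (∀ n : ℕ, ¬ 3 ∣ n → cuspCoeff g₀ n = η⁻¹ (n : ZMod (3 ^ 2)) * cuspCoeff f n) →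
          cuspCoeff g₀ 3 ^ 2 - ((W.psUntwistedTrace : ℤ) : ℂ) * cuspCoeff g₀ 3 + 3 = 0) :
    PSUntwistedLFunctionAtThree := by
  classical
  -- the coefficient field `K = ℚ(ζ₆)` with its two embeddings
  obtain ⟨μ, hμ⟩ : ∃ μ : CyclotomicField 6 ℚ, IsPrimitiveRoot μ 6 := by
    -- a root of `Φ₆` in its splitting field (avoiding the `ℚ`-algebra instance diamond of `IsCyclotomicExtension`)
    have hs := Polynomial.SplittingField.splits (Polynomial.cyclotomic 6 ℚ)
    rw [Polynomial.map_cyclotomic] at hs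
    obtain ⟨μ, hμ⟩ := hs.exists_eval_eq_zero (Polynomial.degree_cyclotomic_pos 6 _ (by norm_num)).ne'
    exact ⟨μ, Polynomial.isRoot_cyclotomic_iff.mp hμ⟩
  let ι : CyclotomicField 6 ℚ →+* ℂ := (IsAlgClosed.lift : CyclotomicField 6 ℚ →ₐ[ℚ] ℂ).toRingHom
  let ιp : CyclotomicField 6 ℚ →+* ℂ_[3] := (IsAlgClosed.lift : CyclotomicField 6 ℚ →ₐ[ℚ] ℂ_[3]).toRingHom
  obtain ⟨δ₀, hδ₀⟩ := exists_sq_eq_neg_three hμ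
  refine PSF1OfStabilisedTwist.psUntwistedLFunctionAtThree_of_print_of_stabilisedTwist ιp ι hmod hlev hGZ86 hGZK
    fun W _ _ hCM hO6 hsurj hev hsq hr N _ f hf ↦ ?_
  obtain ⟨η, hηprim, hη2, hroot⟩ := hN2 W hCM hO6 hsurj hev hsq hr f hf
  obtain ⟨N₀, _, g₀, hg₀, -, h3N₀, hall, hG⟩ := hE hf.1 hηprim hη2
  have hr3 := hroot g₀ hg₀ h3N₀ hall
  obtain ⟨ηK, hηK⟩ := exists_ringHomComp_eq_of_pow_six ι hμ η
  obtain ⟨αK, hαK, hαKroot⟩ := exists_preimage_root_complex ι hδ₀ W hr3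
  haveI : NeZero (3 ^ 2) := ⟨by norm_num⟩
  refine ⟨ηK, αK, N₀, inferInstance, gaussSum η (ZMod.stdAddChar (N := 3 ^ 2)) • g₀, 1, ?_, hαKroot, one_ne_zero,
    fun τ ↦ ?_⟩
  · rw [← Literature.NumberTheory.EllipticCurves.isPrimitive_ringHomComp_iff ι ηK, hηK]
    exact hηprim
  · rw [hαK, hG τ]
    refine congrArg (1 * ·) (Finset.sum_congr rfl fun u _ ↦ ?_)
    rw [← hηK, MulChar.ringHomComp_apply]

end C1

end Summit.BirchSwinnertonDyer.BirchSwinnertonDyer.Theorems.PSC1OfStabilisedUntwist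

end
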